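import Summits.AtomisticToContinuum.HydrodynamicLimit.Theorems.LocalSecondLaw.Negative.Tightness
import Summits.AtomisticToContinuum.HydrodynamicLimit.Theorems.LocalSecondLaw.Negative.RAfterN
import Summits.AtomisticToContinuum.HydrodynamicLimit.Theorems.LocalSecondLaw.Negative.FalseWithoutSupport
import Mathlib.Probability.CentralLimitTheorem
import Mathlib.Probability.Independence.InfinitePi
import Mathlib.MeasureTheory.Measure.Portmanteau

/-!
# Disproof of `LocalSecondLaw` (crux stmt-AtomisticToContinuum-13081, route JParityClosure) — findings

Standing adversary's work file (cycle 1: refuter-cdisprove-stmt-AtomisticToContinuum-13081-0; cycle 2: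
refuter-cdisprove-stmt-AtomisticToContinuum-13081-g2-0, 2026-08-16).  The crux is the
local (Clausius–Duhem) entropy inequality IN PROBABILITY for the cone-mollified empirical fields of
deterministic hard spheres started from local Gibbs data, with the full hard-sphere entropy
`s = 3/2 log θ - log ρ - f_ex(ρσ³)`; limit order `N → ∞` at fixed `r`, then `r → 0`.

## Verdict: NO KILL (file sorry-free).  Why it resists
* The statement is the weak form of `∂ₜH + div(Hu) ≤ 0` for the convex mathematical entropy
  `H = -ρs` with the thermodynamically consistent hard-sphere Gibbs relation (`θ ds = de - p dρ/ρ²`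
  with `p = ρθ(1 + η f_ex')`, `e = 3θ/2`): at global equilibrium every instance tested (constant
  profiles, Galilean drift `u₀ ≠ 0`, velocity/temperature rescaling, `σ → 0`) makes the functional
  tend to `c (∫∫∂ₛφ + ∫φ₀) + c u₀·∫∫∇φ = 0`, i.e. the inequality is TIGHT there, not violated.
* Away from equilibrium a counterexample would be a macroscopic violation of the second law by a
  forward evolution of LOCAL GIBBS data — the global Clausius inequality in expectation is a theorem
  (Liouville + Gibbs variational bound, Spohn 1991 II §3; OVY 1993), the local one is open but
  universally expected; transient fluctuation-theorem violations are `exp(-cN)`-rare and invisible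
  in probability.  No finite-`N` / small-`r` degeneracy is available: `N → ∞` is taken FIRST
  (contrast the refuted small-cell items stmt-9236/9238), and the guard `H := 0` off `{ρ>0, θ>0}`
  only LOWERS `H` in cold spots, which helps the claimed inequality.
* Junk audit: Bochner junk (`∫ = 0`) of the `s`- or `x`-integral can only produce the value
  `I z = 0`; the boundary term is then decisive, so a prover MUST show the time integrand is
  integrable on `Φ.good` (positions continuous, velocities piecewise constant with finitely
  many jumps on `[0,τ]`, `IsHardSphereTrajectory`).  CORRECTION (cycle 2): integrability of the
  `x`-integrand `H(U_r(s,·))(∂ₛφ + u_r·∇φ)` is NOT automatic — its configurational part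
  `ρ_r f_ex(ρ_r σ³)` composes the bare-`limsup` EOS, on which the tree's only local bound is
  `f_ex(η) ≤ −log(1 − 4πη/3)` for `η < 3/(4π) ≈ 0.2387` (`FreeVolume.lean`), with the random local
  density, and hard-core exclusion allows `ρ_r σ³` up to the close-packing value `≈ √2` in a locally jammed ball
  (`∑ᵢ b_r(xᵢ, x₀) ≈ n_loc ∫ b_r = n_loc`, `ρ_r σ³ ≈ n_loc ε_N³`); above `3/(4π)` nothing in the tree bounds
  `f_ex ∘ (ρ_r σ³)` (nor proves it non-integrable — no refuter leverage either; in truth `f_ex` diverges only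
  logarithmically at close packing, so the composition is integrable, but that is HsEos-level knowledge).  So provers should work on the event `{sup_{s ≤ τ, x} ρ_r(s,x) σ³ < 3/(4π)}`,
  of probability `→ 1` by a UNIFORM-in-`(s,x)` density LLN (finite `(s,x)`-net of `N`-independent size:
  `ρ_r` is `3/(πr⁴)`-Lipschitz in `x` and `(3/(πr⁴))√(2 ke)`-Lipschitz in `s`; Chebyshev per net point),
  on which the integrand is bounded and `I z` is the honest integral.  Flow junk off `Φ.good` is
  `localGibbsLaw`-null.
* Fidelity note (inherited, planner): the informal "τ < T" is absent from the signature; harmless.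
* Cycle-2 junk re-audit (no kill): `IsSmoothSpaceTimeOn univ φ` is `ContDiffOn ℝ ∞` of the space–time lift on
  `univ ×ˢ univ` — jointly smooth, so no singular-`deriv` (Cantor-staircase) test function can zero the time term;
  `partialDeriv` = `lineDeriv` of the re-centred lift; `IsHardSphereTrajectory` pins binary elastic collisions from
  incoming left limits, free flight and the domain, so `∀ Φ` ranges only over conull good sets (law ≪ Liouville) — no
  junk flow; `TendstoHydroFieldsAt … 0` pins `(ρ, ρu, E)(0,·)` against every continuous `χ`, hence everywhere (Euler
  data smooth on `Ico 0 T ∋ 0`).  Physics-level regimes re-examined: shear data `u₀ = (f(x₂),0,0)` with constant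
  `a₀, θ₀` (an exact STATIONARY hs-Euler solution, typable like the constant states) — viscous heating produces
  entropy at `O(Kn)`, helping the inequality; pressure-balanced temperature steps — conduction lowers the hot spot's
  entropy density, a genuine LOCAL decrease but `O(Kn) = O(N^{-1/3})`, absorbed by `η` after `N → ∞`; post-shock
  `τ > T` — the Jensen defect of `H(b_r ∗ U)` across a shock layer is `O(r)`, absorbed by `∃ r₀(η)`.  Short of a
  macroscopic second-law violation by forward local-Gibbs evolutions there is no `O(1)` mechanism; the crux is the
  Euler-limit inequality with every finite-`N` transport effect washed out by the order `η, r` fixed → `N → ∞`.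

## (a) Load-bearing hypotheses — theorems
* `localSecondLaw_false_without_lln` (sorry-free, axioms standard): deleting the `t = 0` LLN
  hypothesis makes the crux FALSE — the Euler datum in the boundary term decouples and a hot
  constant state `(1,0,Θ)` sinks it, while the particle functional is bounded above pathwise.
  So any proof must route the boundary term through `TendstoHydroFieldsAt … 0`.
* The Euler PDE itself (`IsHardSphereEulerSolution` beyond its `t = 0` slice, and `0 < T`) is NOT
  used by the statement: only `ρ 0 ·`, `θ 0 ·` enter.  Provers: do not expect help from the PDE.
* `localSecondLaw_false_without_support` (sorry-free, axioms standard): deleting the time-support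
  condition `∃ τ' < τ, ∀ s ≥ τ', φ s · = 0` makes the crux FALSE — `φ ≡ 1` kills the space–time term
  surely and the MATCHED hot equilibrium `(1, e², 0)` has boundary term `f_ex(σ³) - 3 ≤ -1`.  Uses the
  identified LLN (`stub_staticsLLN`, `rhoLim ≡ 1` for unit activity) and the new explicit EOS bound.
* `φ ≥ 0` is load-bearing on paper only (sign flip = approximate entropy CONSERVATION, false once the
  Euler solution shocks, true before): no Lean witness without an entropy-producing evolution.

## (b) A-priori structure provers can USE (all sorry-free)
* `hsExcessFreeEnergy_nonneg : 0 ≤ f_ex`; `hsFreeVolume_ge : Q_N(η) ≥ (1 - 4πη/3)^N` (sequential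
  insertion, Fubini over `Fin (n+1) → 𝕋³ ≃ᵐ 𝕋³ × (Fin n → 𝕋³)`); `hsExcessFreeEnergy_le :
  f_ex(η) ≤ -log(1 - 4πη/3)` for `4πη/3 < 1`; `hsExcessFreeEnergy_le_two : f_ex(σ³) ≤ 2` (`σ ≤ 1/2`) —
  the first explicit two-sided control of the bare-`limsup` equation of state in the tree.
* `integral_cone_eq_one : ∫ b_r(y,·) = 1` exactly for `0 < r < 1/2` (layer cake + Haar volume of
  minimal-image balls) — the normalisation every limit identification `ρ_r → b_r * ρ` needs.
* `Hs_ge : H(ρ_r, θ_r) ≥ -1 - e_r` pointwise (guard included), `integral_cone_le : ∫ b_r ≤ 4`,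
  `integral_kinC_le : ∫ e_r ≤ 4·ke`, `inner_le`, `entropyFunctional_le`: for a space-independent
  non-increasing test function the functional is bounded ABOVE pathwise on `Φ.good` by
  `(ψ 0 - ψ 1)(1 + 4 ke z)` (energy conservation) — one-sided uniform integrability of `I` for free.
  There is NO pathwise lower bound: `H → +∞` logarithmically in locally cold balls, and the
  configurational part `ρ_r f_ex(ρ_r σ³)` has no proved continuity/convexity (bare `limsup`).
* `entropyFunctional` is DEFINITIONALLY the crux's `let`-tower (`change` succeeds), so these lemmas
  apply to the crux verbatim.
* Flow-invariance of the homogeneous local Gibbs law is IN THE TREE (sibling seat, imported here):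
  `Theorems.measurePreserving_flow_localGibbsLaw_const` / `lintegral_comp_flow_localGibbsLaw_const`
  (`JParityClosureOddContactSymmetryGibbsInvariance.lean`); joint measurability of `(s,z) ↦ Φₛ z` on
  `good` is `HardSphereFlow.measurable_flow_prod_torus` (`HardSphereFlowJointMeasurable.lean`) — steps
  (i),(ii) of the tightness programme are therefore available.
* (cycle 2, §(b'')) EXACT TANGENT-PLANE BOOKKEEPING — sharp pathwise form of tightness, no LLN: for a hot
  reference `3/2 log Θ ≥ 5/2`, `H(ρ_r, θ_r) ≥ T_Θ(ρ_r, e_r) := (5/2 − 3/2 log Θ)ρ_r − 1 − e_r/Θ` pointwise, guard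
  INCLUDED (`tangent_le_Hs`: ideal convexity `(3/2)ρ[x − 1 − log x] + [ρ log ρ − ρ + 1] ≥ 0`, `x = θ/Θ`, plus
  `ρ f_ex ≥ 0`; the plane is `≤ −1` on the guard branch); `∫ρ_r = 1` and `∫e_r = ke` EXACTLY
  (`integral_rhoC_eq_one`, `integral_kinC_eq_ke`), so `∫T_Θ = 3/2 − 3/2 log Θ − ke/Θ` (`integral_tangent_eq`) and on
  `Φ.good`, for `φ = ψ(s)` non-increasing: `I(z) ≤ (ψ0 − ψ1)(3/2 log Θ − 3/2 + ke(z)/Θ)` (`entropyFunctional_le_hot`),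
  i.e. with the matched boundary term `I + init ≤ f_ex(σ³) + (ke(z) − 3Θ/2)/Θ` SURELY (`entropyFunctional_add_init_le`),
  and `P_N(I + init ≥ f_ex(σ³) + t) ≤ K/(2(N+1)t²)` (`localGibbsLaw_saturation_tail`, conditional Chebyshev for the
  conserved kinetic energy).  So at equilibrium the room in the crux is at most `f_ex(σ³) = O(σ³)` plus the
  `O_P(N^{-1/2})` canonical energy fluctuation, and the WHOLE difficulty of the equilibrium case is the opposite
  inequality `∫H(U_r) ≤ H̄ + η`: the convexity DEFECT `(3/2)ρ_r[θ_r/Θ − 1 − log(θ_r/Θ)] + [ρ_r log ρ_r − ρ_r + 1]`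
  (small in probability by a uniform-in-`x` LLN; cold populated balls the only danger) and the excess part
  `∫ρ_r f_ex(ρ_r σ³) dx ≤ f_ex(σ³) + o(1)`, which needs only UPPER semicontinuity of the bare-`limsup` EOS at `σ³`
  (= right-continuity: `f_ex` is non-decreasing on `[0, 3/(4π))` — `HsFreeEnergyConvex.hsExcessFreeEnergy_mono_of`
  (`Theorems/CollisionIsometryCLTHsFreeEnergyConvexBasic.lean`) fed with `hsFreeVolume_ge`, which keeps `Q_N ≥ (1 − 4πη/3)^N > 0`
  and the rates bounded there; continuity on the open band would also follow from the convexity item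
  `HsFreeEnergyConvex`, stmt-AtomisticToContinuum-9526, if it lands) — Ruelle's subadditivity (`f_ex = inf` of continuous functions up to vanishing corrections) would give usc
  without any cluster expansion; the tree's `HardSphereEulerRatio.ratioLimit` (analytic insertion ratio at small `σ`)
  is the other road to `HsEosLowDensity` (stmt-0768).
* LANDED under `Theorems/LocalSecondLaw/Negative/` (namespace `…Theorems.LocalSecondLawNegative`; since cycle 2 this
  workfile IMPORTS them instead of carrying copies — every cycle-1 declaration listed in this docblock lives there
  under the same short name; cycle-2 files pending: `UniformN` p80715, `Saturation` p80809, `KineticEnergyCLT` p80994): `Functional` (p73902: pieces + a-priori bounds), `FreeVolume` (p73893: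
  EOS bound), `FalseWithoutLLN` (p74742), `FalseWithoutSupport` (p75347), `ConeNormalisation` (p75062:
  `∫ b_r = 1`), `LinearMajorant` (p75058: step A), `EnergyFluctuation` (p75361: step D2), `EquilibriumL1`
  (p75763: steps D1, D), `TimeIntegral` (p75377: step C, `flowReg`), `HomogeneousLLN` (p75406),
  `Tightness` (p75866: `not_localSecondLawGapAt`, `not_localSecondLawStrictGap`), `RAfterN` (p75764).
  Sibling helpers: `DensityCap/Negative/MollifiedDensity.lean` (`DensityCapNegative.cone`, `coneMass`),
  `JParityClosureOddContactSymmetryGibbsInvariance.lean` (flow-invariance of the homogeneous law).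

## (c) Natural strengthenings (status)
* Positive gap: for EVERY `c > 0` the variant with event `{I + init < c}` is FALSE
  (`not_localSecondLawGapAt`, sorry-free, axioms standard; `not_localSecondLawStrictGap` is its corollary):
  the local entropy inequality is SATURATED at global equilibrium, so no proof of the crux can yield any
  uniform positive entropy production and every estimate must be sharp there.  Proof = the tightness programme of this
  file: linear majorant `-H ≤ |e_r - 3/2| + (5/2)|ρ_r - 1|` (step A), pathwise `I ≤ ∫(-ψ')Dev(Φₛz)`,
  `E_N[∫(-ψ')Dev(Φₛ·)] = E_N[Dev]` by Tonelli through a measurable modification of the flow + the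
  sibling seat's flow-invariance (step C), `E_N[Dev] → 0` by the `t = 0` LLN in `L¹` for `ρ_r`
  (`∫ b_r = 1`), the tree's conditional Chebyshev bound + layer cake for `e_r - (3/2)ρ_r`, and dominated
  convergence over the field point (step D); Markov.  The guard kills the pathwise Jensen shortcut,
  which is why the proof runs through expectations.
* `∃ r₀` moved after `∀ N` (mollifier shrinking with `N`): FALSE — `not_localSecondLawRAfterN` (sorry-free,
  §(c')).  NOT junk-true as for `RateFloor` (`RateFloor/Negative/RAfterN.lean`) but junk-DECIDED BY THE
  BOUNDARY TERM: for `2r < ε_N` every ball holds at most one centre (`Hs_rhoC_thetaC_eq_zero_of_sep`: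
  hard-sphere exclusion + torus triangle inequality), `θ_r ≡ 0`, the guard gives `H ≡ 0`, `I z = 0` surely on
  `Φ.good` (`entropyFunctional_eq_zero_of_sep`), and the event is `{init < -η}` — everything for the hot
  matched data `(1, e², 0)`.  So the filed order `∃ r₀ ∀ r ∃ N₀(r)` (`N r³ → ∞` centres per ball) is
  exactly what gives the empirical temperature content; a proof that never uses `ε_N ≪ r` is wrong.
* `N₀` uniform in `r` (`∃ r₀ ∃ N₀ ∀ r < r₀ ∀ N ≥ N₀`): FALSE — `not_localSecondLawUniformN` (cycle 2, §(c''),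
  sorry-free, axioms standard): singleton balls at the FIXED `N₀` (`r < ε_{N₀}/2`), boundary term decides for the hot
  matched equilibrium.  With `not_localSecondLawRAfterN`: `N₀(r) → ∞` as `r → 0` is forced, at least `ε_{N₀(r)} ≲ r`,
  i.e. `N₀(r) ≳ (σ/r)³`.
* `η = 0` (event `{I + init < 0}`): NOT refuted in Lean — near-miss, see §(f) of this docblock.  At equilibrium
  `I + init = [f_ex(σ³) − ∫∫(−ψ′)∫ρ_r f_ex(ρ_rσ³)] − [convexity defect] + (ke − 3Θ/2)/Θ` exactly (§(b'')); the energy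
  fluctuation is symmetric at scale `N^{-1/2}` (`P(ke < 3Θ/2) → 1/2`: median of `χ²` below its mean), the defect is
  `O_P(1/(N r³)) = o_P(N^{-1/2})`, so the `η = 0` variant is FALSE iff the excess part saturates to `o(N^{-1/2})` — true
  (`Var ρ_r(x) = O(1/(N r³))`, `f_ex` a.e.-differentiable as a monotone function and `σ` choosable at a
  differentiability point, `∫(ρ_r − 1) = 0` killing the linear term) but its proof needs a QUANTITATIVE two-point
  cluster bound (the tree's `HardSphereEulerLLN.tendsto_variance` is qualitative, via Tannery) and a Paley–Zygmund
  lower bound `P(χ²_{3n} ≤ 3n) ≥ 1/60` (fourth moments of sums); both absent.  Take-away for provers: the tolerance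
  `η` is consumed at equilibrium ONLY by the canonical energy fluctuation and the EOS term — a proof may spend it
  nowhere else.
* `δ = 0` / sure version: false by Maxwellian tails / velocity reversal
  (`Literature.Barriers.AtomisticToContinuum.VelocityReversalBarrier`), as for every in-probability
  item; uninformative, not pursued.

## (d) For provers: what the equilibrium case alone already needs
* The tightness proof above uses only `f_ex ≥ 0` and the VALUE `f_ex(σ³)`; the crux itself at global
  equilibrium needs the opposite bound `H(ρ_r,θ_r) ≤ f_ex(σ³) + o(1)`, i.e. `ρ_r f_ex(ρ_r σ³) → f_ex(σ³)` as
  `ρ_r → 1`: CONTINUITY of the bare-`limsup` `hsExcessFreeEnergy` at `σ³`.  Nothing in the tree gives it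
  (monotonicity in `η` is provable; continuity is the content of the open support item HsEosLowDensity,
  stmt-AtomisticToContinuum-0768).  So even the trivial-dynamics case of `LocalSecondLaw` is conditional on
  the hard-sphere equation of state being continuous at the working density — budget for it.
* Cold spots: the guard makes `H = 0` where `θ_r = 0`; for the crux's direction this HELPS (it lowers `H`),
  so provers never need to control isolated particles — only `ρ_r log ρ_r`, `ρ_r f_ex(ρ_r σ³)` from above and
  `-(3/2)ρ_r log θ_r` from above (i.e. `θ_r` from below on `{θ_r > 0}` … which is again free: `-log θ_r ≤
  θ_r⁻¹ - 1` is useless, but `-(3/2)ρ_r log θ_r ≤ 0` whenever `θ_r ≥ 1`; the dangerous region is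
  `0 < θ_r ≪ 1` with `ρ_r` not small — locally cold but populated balls, an `L¹`-small set at equilibrium by
  the same Chebyshev bound `lintegral_fluct_le` read from below).

## (f) Near-miss (cycle 2): the `η = 0` variant — reduction complete, two quantitative inputs missing
* Statement: `LocalSecondLawZeroEta` := the crux with `∀ η δ, 0 < η → 0 < δ → …{I + init < −η}` replaced by
  `∀ δ, 0 < δ → … {I + init < 0}` (not typed in this file to keep it sorry-free; obtain it from the route decl by
  that textual edit).  Claim: FALSE at the hot homogeneous equilibrium `(1, e², 0)` with `φ = ψ(s)`.
* Reduction (the sorry-free pieces are in §(b'')): on `Φ.good`, `I + init = ∫(−ψ′)[H̄ − ∫H(U_r(Φₛz))dx]ds`,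
  `∫H(U_r)dx ≥ ∫T_Θ(U_r)dx + ∫_G ρ_r f_ex(ρ_rσ³)dx` for every measurable `G ⊆ {guard off}` (`f_ex ≥ 0`), and
  `∫T_Θ dx = H̄_id − (ke − 3Θ/2)/Θ` exactly; hence `{I + init < 0} ⊇ good ∩ {ke < 3Θ/2 − Θ·E(z)}` with the excess
  deficit `E(z) := sup_{s ≤ 1/2} [f_ex(σ³) − ∫ρ_r f_ex(ρ_rσ³)(Φₛz) dx]₊` (by flow-invariance `E_N` of the time average
  of the bracket equals its `t = 0` expectation).
* Missing input (I1) (statics, quantitative): `E_N[E₊] = o(N^{-1/2})` at fixed `r`.  Bookkeeping (truncate the excess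
  part to `{ρ_r ≤ 2}` where `f_ex ≤ −log(1 − 8πσ³/3)` is bounded — allowed since `f_ex ≥ 0` is only DROPPED; linearise
  `ρ f_ex(ρσ³) = f_ex(σ³) + c(ρ − 1) + o(ρ − 1)` at a differentiability point `σ³` of the monotone `f_ex` — free, the
  refuter picks `σ`; kill the linear term with `∫(ρ_r − 1) = 0`; guard set `{θ_r = 0 < ρ_r} ∪ {ρ_r = 0}` ⊆
  {coincident velocities} ∪ {|ρ_r − 1| ≥ 1/2}`, null ∪ Chebyshev) reduces EVERYTHING to the single variance bound
  `E_Gibbs|ρ_r(x) − 1|² ≤ C(r, σ)/(N+1)` — ANY constant `C(r, σ)`, only the order `1/N` matters (then Cauchy–Schwarz on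
  `{|ρ_r − 1| > t}` and `ε(t) → 0`).  The tree's `HardSphereEulerLLN.tendsto_variance` (Tannery) is qualitative; the
  rate needs `|onePt − I|, |twoPt − I²| = O_χ(1/N)` from `HardSphereEulerRatio`, i.e. a quantitative pass over the
  canonical cluster expansion — out of this seat's budget.  A direct exchangeability/insertion argument only closes
  to `Var = O(σ¹²)` (the overlap term's correlation with the fluctuation IS the two-point cluster content).
* Input 2 (probability) — SUPPLIED this cycle (§(f'), landed `Negative/KineticEnergyCLT.lean`):
  `P(G < a) ≤ liminf_N P_N(ke − 3Θ/2 < a (N+1)^{-1/2})`, `G ~ N(0, limVar Θ)` non-degenerate, for every real `a`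
  (Mathlib CLT + portmanteau + disintegration); so `liminf_N P_N(ke < 3Θ/2 − aΘ(N+1)^{-1/2}) ≥ P(G < −aΘ) > 0`.
  Hence `¬ LocalSecondLawZeroEta` is now EXACTLY modulo the statics input (I1) below.
* Why it matters little: `η > 0` being load-bearing is expected by everyone; the informative residue is the
  take-away recorded in §(c).

## (e) Targets: none yet (no line picked at cycle 2 either; `stuck_stubs = []`).  The triage panel (TRIAGE-r1-1..3)
flags the typed first lemmas `EvenBudget`, `RelativeOddBound`, `TruncatedOddExchangeLowerBound`, `ProductionBudget`
(IdeatorTwoSketch / ideator-1 Sketch) as false at fixed `r` by the mixture floor — a LOCAL-EQUILIBRIUM-dynamics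
argument, not Lean-checkable here (at GLOBAL equilibrium, the only tractable law, those split statistics → 0); they
become `-- Targets` only if a picked line keeps them.
-/

noncomputable section

open MeasureTheory Filter Set Topology
open scoped ENNReal
open Literature.MathematicalPhysics.KineticTheory Literature.Analysis.FluidPDE

namespace Summit.AtomisticToContinuum.HydrodynamicLimit.Cruxes.LocalSecondLaw.Disproof

/-! ## Cycle-1 content: imported from the landed `Theorems/LocalSecondLaw/Negative/*` modules

The definitions of the crux's pieces (`cone`, `rhoC`, `momC`, `kinC`, `thetaC`, `Hs`, `ke`, `entropyFunctional`,
defeq to the crux's `let`-tower), the a-priori bounds, the free-volume EOS bound, the load-bearing-hypothesis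
refutations (`localSecondLaw_false_without_lln`, `localSecondLaw_false_without_support`), the tightness programme
(`not_localSecondLawGapAt`, `not_localSecondLawStrictGap`) and the order-swap refutation (`not_localSecondLawRAfterN`)
are used below through an explicit `open … (names)` of `…Theorems.LocalSecondLawNegative`; the aliases keep the
cycle-1 theorem names addressable in this namespace. -/

open Summit.AtomisticToContinuum.HydrodynamicLimit.Theorems.LocalSecondLawNegative
  (cone rhoC momC kinC thetaC Hs ke entropyFunctional psi psi_contDiff psi_antitone psi_zero psi_eq_zero psi_nonneg
   constState_isSolution homogeneous_lln_identified hsExcessFreeEnergy_nonneg hsExcessFreeEnergy_le_two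
   hsExcessFreeEnergy_le entropyFunctional_eq_zero_of_sep Hs_rhoC_thetaC_eq_zero_of_sep sub_one_le_mul_log
   rhoC_nonneg kinC_nonneg kinC_eq_sum continuous_rhoC continuous_kinC continuous_cone cone_nonneg
   integral_cone_eq_one ke_nonneg ke_flow_eq continuous_ke entropyFunctional_le entropyFunctional_le_Dev Hs_ge
   integral_cone_le integral_kinC_le hsFreeVolume_ge)

/-- Alias (cycle 1, landed `FalseWithoutLLN.lean` p74742): the `t = 0` LLN hypothesis is load-bearing. [folklore] -/
theorem localSecondLaw_false_without_lln :
    ¬ Summit.AtomisticToContinuum.HydrodynamicLimit.Theorems.LocalSecondLawNegative.LocalSecondLawWithoutLLN :=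
  Summit.AtomisticToContinuum.HydrodynamicLimit.Theorems.LocalSecondLawNegative.localSecondLaw_false_without_lln

/-- Alias (cycle 1, landed `FalseWithoutSupport.lean` p75347): the time-support hypothesis is load-bearing. [folklore] -/
theorem localSecondLaw_false_without_support :
    ¬ Summit.AtomisticToContinuum.HydrodynamicLimit.Theorems.LocalSecondLawNegative.LocalSecondLawWithoutSupport :=
  Summit.AtomisticToContinuum.HydrodynamicLimit.Theorems.LocalSecondLawNegative.localSecondLaw_false_without_support

/-- Alias (cycle 1, landed `Tightness.lean` p75866): no `c`-gap for any `c > 0`. [folklore] -/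
theorem not_localSecondLawGapAt {c : ℝ} (hc : 0 < c) :
    ¬ Summit.AtomisticToContinuum.HydrodynamicLimit.Theorems.LocalSecondLawNegative.LocalSecondLawGapAt c :=
  Summit.AtomisticToContinuum.HydrodynamicLimit.Theorems.LocalSecondLawNegative.not_localSecondLawGapAt hc

/-- Alias (cycle 1, landed `Tightness.lean` p75866): the strict-gap strengthening is false. [folklore] -/
theorem not_localSecondLawStrictGap :
    ¬ Summit.AtomisticToContinuum.HydrodynamicLimit.Theorems.LocalSecondLawNegative.LocalSecondLawStrictGap :=
  Summit.AtomisticToContinuum.HydrodynamicLimit.Theorems.LocalSecondLawNegative.not_localSecondLawStrictGap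

/-- Alias (cycle 1, landed `RAfterN.lean` p75764): the order-swapped variant is false. [folklore] -/
theorem not_localSecondLawRAfterN :
    ¬ Summit.AtomisticToContinuum.HydrodynamicLimit.Theorems.LocalSecondLawNegative.LocalSecondLawRAfterN :=
  Summit.AtomisticToContinuum.HydrodynamicLimit.Theorems.LocalSecondLawNegative.not_localSecondLawRAfterN

variable {N : ℕ}

/-! ## (c'') Cycle 2 — the variant with `N₀` uniform in `r`: FALSE (singleton balls at the fixed `N₀`)

Landing as `Theorems/LocalSecondLaw/Negative/UniformN.lean` (p80715). -/

/-- The crux `LocalSecondLaw` VERBATIM with `∃ N₀` moved BEFORE `∀ r ∈ (0, r₀)` (a particle-number threshold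
uniform in the mollification radius). -/
def LocalSecondLawUniformN : Prop :=
  ∀ (a₀ θ₀ : Literature.MathematicalPhysics.KineticTheory.T3 → ℝ) (u₀ : Literature.MathematicalPhysics.KineticTheory.T3 → Literature.MathematicalPhysics.KineticTheory.V3), Continuous a₀ → Continuous θ₀ → Continuous u₀ → (∀ x, 0 < a₀ x) → (∀ x, 0 < θ₀ x) → ∃ σ₀ : ℝ, 0 < σ₀ ∧ ∀ σ : ℝ, 0 < σ → σ < σ₀ → ∀ (T : ℝ) (ρ θ : ℝ → Literature.MathematicalPhysics.KineticTheory.T3 → ℝ) (u : ℝ → Literature.MathematicalPhysics.KineticTheory.T3 → Literature.MathematicalPhysics.KineticTheory.V3), Literature.MathematicalPhysics.KineticTheory.IsHardSphereEulerSolution σ T ρ u θ → ∀ Φ : (N : ℕ) → Literature.Analysis.FluidPDE.HardSphereFlow (Literature.Analysis.FluidPDE.Torus.geometry (Fin 3)) (Literature.MathematicalPhysics.KineticTheory.hsDiameter σ N) (N + 1), Literature.MathematicalPhysics.KineticTheory.TendstoHydroFieldsAt (fun N => Literature.MathematicalPhysics.KineticTheory.localGibbsLaw σ a₀ u₀ θ₀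 N (Φ N)) Φ ρ u θ 0 → 0 < T → ∀ τ : ℝ, 0 < τ → ∀ φ : ℝ → Literature.MathematicalPhysics.KineticTheory.T3 → ℝ, Literature.Analysis.FunctionSpaces.Torus.IsSmoothSpaceTimeOn Set.univ φ → (∀ s x, 0 ≤ φ s x) → (∃ τ' : ℝ, τ' < τ ∧ ∀ s, τ' ≤ s → ∀ x, φ s x = 0) → ∀ η δ : ℝ, 0 < η → 0 < δ → ∃ r₀ : ℝ, 0 < r₀ ∧ ∃ N₀ : ℕ, ∀ r : ℝ, 0 < r → r < r₀ → ∀ N : ℕ, N₀ ≤ N → let γ : Literature.Analysis.FluidPDE.Config (N + 1) (Fin 3) Literature.MathematicalPhysics.KineticTheory.T3 → ℝ → Literature.Analysis.FluidPDE.Config (N + 1) (Fin 3) Literature.MathematicalPhysics.KineticTheory.T3 := fun z s => (Φ N).flow s z; let bx : Literature.MathematicalPhysics.KineticTheory.T3 → Literature.MathematicalPhysics.KineticTheory.T3 → ℝ := fun x y => 3 / (Real.pi * r ^ 3) * max (1 - Literature.Analysis.FluidPDE.Torus.euclidDist x y / r) 0; let ρm : Literature.Analysis.FluidPDE.Config (N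 + 1) (Fin 3) Literature.MathematicalPhysics.KineticTheory.T3 → ℝ → Literature.MathematicalPhysics.KineticTheory.T3 → ℝ := fun z s x₀ => ∫ q, bx q.1 x₀ ∂(Literature.Analysis.FluidPDE.empiricalMeasure (γ z s)); let mm : Literature.Analysis.FluidPDE.Config (N + 1) (Fin 3) Literature.MathematicalPhysics.KineticTheory.T3 → ℝ → Literature.MathematicalPhysics.KineticTheory.T3 → Literature.MathematicalPhysics.KineticTheory.V3 := fun z s x₀ => ∫ q, bx q.1 x₀ • q.2 ∂(Literature.Analysis.FluidPDE.empiricalMeasure (γ z s)); let em : Literature.Analysis.FluidPDE.Config (N + 1) (Fin 3) Literature.MathematicalPhysics.KineticTheory.T3 → ℝ → Literature.MathematicalPhysics.KineticTheory.T3 → ℝ := fun z s x₀ => ∫ q, bx q.1 x₀ * (‖q.2‖ ^ 2 / 2) ∂(Literature.Analysis.FluidPDE.empiricalMeasure (γ z s)); let θm : Literature.Analysis.FluidPDE.Config (N + 1) (Fin 3) Literature.MathematicalPhysics.KineticTheory.T3 → ℝ → Literature.MathematicalPhysics.KineticTheory.T3 → ℝ := fun z s x₀ => 2 / 3 * (em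 z s x₀ / ρm z s x₀ - ‖mm z s x₀‖ ^ 2 / (2 * ρm z s x₀ ^ 2)); let Hs : ℝ → ℝ → ℝ := fun a b => if 0 < a ∧ 0 < b then -(a * (3 / 2 * Real.log b - Real.log a - Literature.MathematicalPhysics.KineticTheory.hsExcessFreeEnergy (a * σ ^ 3))) else 0; let I : Literature.Analysis.FluidPDE.Config (N + 1) (Fin 3) Literature.MathematicalPhysics.KineticTheory.T3 → ℝ := fun z => ∫ s in Set.Icc (0 : ℝ) τ, ∫ x : Literature.MathematicalPhysics.KineticTheory.T3, Hs (ρm z s x) (θm z s x) * (deriv (fun s' => φ s' x) s + ∑ k : Fin 3, (mm z s x) k / ρm z s x * Literature.Analysis.FunctionSpaces.Torus.partialDeriv k (φ s) x); Literature.MathematicalPhysics.KineticTheory.localGibbsLaw σ a₀ u₀ θ₀ N (Φ N) {z | I z + ∫ x : Literature.MathematicalPhysics.KineticTheory.T3, Hs (ρ 0 x) (θ 0 x) * φ 0 x < -η} ≤ ENNReal.ofReal δ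

/-- **`LocalSecondLaw` with `N₀` uniform in `r` is FALSE.**  Witness: homogeneous hot local Gibbs data
`(a₀, θ₀, u₀) = (1, e², 0)`, the matched constant Euler state `(1, 0, e²)` (identified `t = 0` LLN,
`homogeneous_lln_identified`), Alexander's flows, `φ(s, x) = ψ(s)` (`psi`), `τ = T = 1`, `η = δ = 1/2`; given the
claimed `r₀, N₀` take `N = N₀` and `r = min (r₀/2) (ε_{N₀}/4)`: the functional vanishes on `Φ.good`
(`entropyFunctional_eq_zero_of_sep`) and the boundary term is `f_ex(σ³) - 3 ≤ -1` (`hsExcessFreeEnergy_le_two`),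
so the event has probability `1 > 1/2`. [folklore] -/
theorem not_localSecondLawUniformN : ¬ LocalSecondLawUniformN := by
  intro h
  set θ₀ : ℝ := Real.exp 2 with hθ₀
  have hθ₀pos : 0 < θ₀ := Real.exp_pos 2
  have hc1 : Continuous (fun _ : T3 => (1 : ℝ)) := continuous_const
  have hcθ : Continuous (fun _ : T3 => θ₀) := continuous_const
  have hc0 : Continuous (fun _ : T3 => (0 : V3)) := continuous_const
  obtain ⟨σ₀, hσ₀, h1⟩ := h (fun _ => 1) (fun _ => θ₀) (fun _ => 0) hc1 hcθ hc0
    (fun _ => one_pos) (fun _ => hθ₀pos)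
  obtain ⟨σ₁, hσ₁, -, hL⟩ := homogeneous_lln_identified hθ₀pos
  obtain ⟨σ, hσpos, hσlt0, hσlt1, hσhalf⟩ : ∃ σ : ℝ, 0 < σ ∧ σ < σ₀ ∧ σ < σ₁ ∧ σ < 2⁻¹ := by
    refine ⟨min (min σ₀ σ₁) 2⁻¹ / 2, by positivity, ?_, ?_, ?_⟩ <;>
      linarith [min_le_left (min σ₀ σ₁) (2⁻¹ : ℝ), min_le_right (min σ₀ σ₁) (2⁻¹ : ℝ),
        min_le_left σ₀ σ₁, min_le_right σ₀ σ₁, lt_min (lt_min hσ₀ hσ₁) (show (0 : ℝ) < 2⁻¹ by norm_num)]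
  have hσhalf' : σ ≤ 1 / 2 := by rw [one_div]; exact hσhalf.le
  let Φ : (N : ℕ) → HardSphereFlow (Torus.geometry (Fin 3)) (hsDiameter σ N) (N + 1) := fun N =>
    Classical.choice (HardSphereFlow.nonempty_torus_holds (d := Fin 3) (hsDiameter_pos hσpos N)
      (lt_of_le_of_lt (hsDiameter_le hσpos.le N) hσhalf) (N + 1))
  have hT := hL σ hσpos hσlt1 Φ
  have hsol := constState_isSolution σ 1 hθ₀pos
  have hsmooth : Literature.Analysis.FunctionSpaces.Torus.IsSmoothSpaceTimeOn Set.univ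
      (fun (s : ℝ) (_ : T3) => psi s) := by
    show ContDiffOn ℝ _ (fun p : ℝ × EuclideanSpace ℝ (Fin 3) => psi p.1) _
    exact (psi_contDiff.comp contDiff_fst).contDiffOn
  obtain ⟨r₀, hr₀, N₀, h4⟩ := h1 σ hσpos hσlt0 1 (fun _ _ => 1) (fun _ _ => θ₀) (fun _ _ => 0) hsol Φ hT
    one_pos 1 one_pos (fun s _ => psi s) hsmooth (fun s _ => psi_nonneg s)
    ⟨1 / 2, by norm_num, fun s hs _ => psi_eq_zero hs⟩ (1 / 2) (1 / 2) (by norm_num) (by norm_num)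
  have hε := hsDiameter_pos hσpos N₀
  set r : ℝ := min (r₀ / 2) (hsDiameter σ N₀ / 4) with hr
  have hrpos : 0 < r := by positivity
  have hrlt : r < r₀ := lt_of_le_of_lt (min_le_left _ _) (by linarith)
  have h2r : 2 * r < hsDiameter σ N₀ := by
    have := min_le_right (r₀ / 2) (hsDiameter σ N₀ / 4); linarith
  have h5 := h4 r hrpos hrlt N₀ le_rfl
  change localGibbsLaw σ (fun _ => 1) (fun _ => 0) (fun _ => θ₀) N₀ (Φ N₀)
      {z | entropyFunctional σ r 1 (fun s _ => psi s) (Φ N₀) z +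
        ∫ x : T3, Hs σ ((fun _ _ => (1 : ℝ)) 0 x) ((fun _ _ => θ₀) 0 x) *
          (fun (s : ℝ) (_ : T3) => psi s) 0 x < -(1 / 2)} ≤ ENNReal.ofReal (1 / 2) at h5
  haveI : IsProbabilityMeasure (localGibbsLaw σ (fun _ => 1) (fun _ => 0) (fun _ => θ₀) N₀ (Φ N₀)) :=
    isProbabilityMeasure_localGibbsLaw hc1 hcθ hc0 (fun _ => one_pos) (fun _ => hθ₀pos) hσhalf' N₀ (Φ N₀)
  have hHs : Hs σ 1 θ₀ = hsExcessFreeEnergy (1 * σ ^ 3) - 3 := by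
    unfold Hs
    rw [if_pos ⟨one_pos, hθ₀pos⟩, Real.log_one, hθ₀, Real.log_exp]
    ring
  have hinit : (∫ x : T3, Hs σ ((fun _ _ => (1 : ℝ)) 0 x) ((fun _ _ => θ₀) 0 x) *
      (fun (s : ℝ) (_ : T3) => psi s) 0 x) = hsExcessFreeEnergy (1 * σ ^ 3) - 3 := by
    show (∫ _ : T3, Hs σ 1 θ₀ * psi 0) = _
    rw [integral_const, psi_zero, mul_one, hHs]
    simp
  have hf2 : hsExcessFreeEnergy (1 * σ ^ 3) ≤ 2 := by
    rw [one_mul]; exact hsExcessFreeEnergy_le_two hσpos.le hσhalf'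
  have hgood : (Φ N₀).good ⊆ {z | entropyFunctional σ r 1 (fun s _ => psi s) (Φ N₀) z +
        ∫ x : T3, Hs σ ((fun _ _ => (1 : ℝ)) 0 x) ((fun _ _ => θ₀) 0 x) *
          (fun (s : ℝ) (_ : T3) => psi s) 0 x < -(1 / 2)} := by
    intro z hz
    rw [Set.mem_setOf_eq, entropyFunctional_eq_zero_of_sep hrpos h2r (Φ N₀) 1 _ hz, hinit]
    linarith
  have hg1 : localGibbsLaw σ (fun _ => 1) (fun _ => 0) (fun _ => θ₀) N₀ (Φ N₀) (Φ N₀).good = 1 := by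
    have hac : localGibbsLaw σ (fun _ => 1) (fun _ => 0) (fun _ => θ₀) N₀ (Φ N₀) ≪
        liouville (Torus.geometry (Fin 3)) (N₀ + 1) (hsDiameter σ N₀) :=
      withDensity_absolutelyContinuous _ _
    have h0 : localGibbsLaw σ (fun _ => 1) (fun _ => 0) (fun _ => θ₀) N₀ (Φ N₀) ((Φ N₀).good)ᶜ = 0 :=
      hac (Φ N₀).measure_compl_good
    have := prob_add_prob_compl (μ := localGibbsLaw σ (fun _ => 1) (fun _ => 0) (fun _ => θ₀) N₀ (Φ N₀))
      (Φ N₀).measurableSet_good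
    rwa [h0, add_zero] at this
  have h6 : (1 : ℝ≥0∞) ≤ ENNReal.ofReal (1 / 2) := by
    rw [← hg1]; exact (measure_mono hgood).trans h5
  have h7 : (1 : ℝ≥0∞).toReal ≤ 1 / 2 := ENNReal.toReal_le_of_le_ofReal (by norm_num) h6
  norm_num at h7

/-! ## (b'') Cycle 2 — exact saturation at equilibrium: the tangent-plane bookkeeping

Landing as `Theorems/LocalSecondLaw/Negative/Saturation.lean` (p80809).  The guarded entropy lies above its ideal tangent
plane at the hot reference state `(1, 0, 3Θ/2)`, `3/2 log Θ ≥ 5/2`, pointwise INCLUDING the guard; the plane is linear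
in the conserved densities, whose mollified integrals are exact (`∫ρ_r = 1`, `∫e_r = ke`), so mass + energy
conservation integrate it in closed form and the crux functional obeys a SURE upper bound on `Φ.good` with no law of
large numbers: `I + init ≤ f_ex(σ³) + (ke − 3Θ/2)/Θ`.  Chebyshev for the conserved kinetic energy then gives the
quantitative saturation `P_N(I + init ≥ f_ex(σ³) + t) ≤ K/(2(N+1)t²)`. -/

/-! ## The tangent plane of the ideal entropy at the hot reference state -/

/-- The tangent plane `T_Θ(ρ, e) = (5/2 - 3/2 log Θ) ρ - 1 - e/Θ` of the ideal mathematical entropy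
`-ρ(3/2 log θ - log ρ)` at the reference state `(ρ, m, e) = (1, 0, 3Θ/2)` (the `m`-slope vanishes there), as a
function of the density and the kinetic energy density. [folklore] -/
def tangent (Θ a e : ℝ) : ℝ :=
  (5 / 2 - 3 / 2 * Real.log Θ) * a - 1 - e / Θ

/-- `x - 1 - log x ≥ 0` for `x > 0`. [folklore] -/
theorem sub_one_sub_log_nonneg {x : ℝ} (hx : 0 < x) : 0 ≤ x - 1 - Real.log x := by
  have := Real.log_le_sub_one_of_pos hx
  linarith

/-- **The ideal tangent-plane (convexity) inequality**: for `ρ, θ, Θ > 0` and `e ≥ (3/2)ρθ`,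
`-ρ(3/2 log θ - log ρ) - T_Θ(ρ, e) ≥ (3/2)ρ[θ/Θ - 1 - log(θ/Θ)] + [ρ log ρ - ρ + 1] ≥ 0`. [folklore] -/
theorem tangent_le_ideal {Θ a θ e : ℝ} (hΘ : 0 < Θ) (ha : 0 < a) (hθ : 0 < θ)
    (he : 3 / 2 * a * θ ≤ e) :
    tangent Θ a e ≤ -(a * (3 / 2 * Real.log θ - Real.log a)) := by
  have hx : 0 < θ / Θ := div_pos hθ hΘ
  have hlog : Real.log θ = Real.log (θ / Θ) + Real.log Θ := by
    rw [Real.log_div hθ.ne' hΘ.ne']; ring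
  have h1 : 0 ≤ a * (θ / Θ - 1 - Real.log (θ / Θ)) := mul_nonneg ha.le (sub_one_sub_log_nonneg hx)
  have h2 : 0 ≤ a * Real.log a - a + 1 := by linarith [sub_one_le_mul_log ha]
  have h3 : 3 / 2 * a * (θ / Θ) ≤ e / Θ := by
    rw [show 3 / 2 * a * (θ / Θ) = 3 / 2 * a * θ / Θ by ring]
    exact div_le_div_of_nonneg_right he hΘ.le
  have key : -(a * (3 / 2 * Real.log θ - Real.log a)) - tangent Θ a e =
      3 / 2 * (a * (θ / Θ - 1 - Real.log (θ / Θ))) + (a * Real.log a - a + 1) +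
        (e / Θ - 3 / 2 * a * (θ / Θ)) := by
    unfold tangent
    rw [hlog]
    ring
  linarith

/-- **Pointwise tangent bound for the guarded entropy of the crux** at a hot reference temperature
`3/2 log Θ ≥ 5/2`: `T_Θ(ρ_r, e_r) ≤ H(ρ_r, θ_r)` for EVERY configuration and field point — on the guard branch
the plane is `≤ -1 < 0 = H`, on the main branch this is `tangent_le_ideal` (`(3/2)ρ_r θ_r = e_r - |m_r|²/(2ρ_r)
≤ e_r`) plus `ρ_r f_ex(ρ_r σ³) ≥ 0`. [folklore] -/
theorem tangent_le_Hs {σ r Θ : ℝ} (hr : 0 < r) (hΘ : 0 < Θ) (hhot : 5 / 2 ≤ 3 / 2 * Real.log Θ)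
    (w : Config (N + 1) (Fin 3) T3) (x₀ : T3) :
    tangent Θ (rhoC r w x₀) (kinC r w x₀) ≤ Hs σ (rhoC r w x₀) (thetaC r w x₀) := by
  have ha0 : 0 ≤ rhoC r w x₀ := rhoC_nonneg hr w x₀
  have he0 : 0 ≤ kinC r w x₀ := kinC_nonneg hr w x₀
  unfold Hs
  split_ifs with h
  · obtain ⟨ha, hθ⟩ := h
    have hf : 0 ≤ rhoC r w x₀ * hsExcessFreeEnergy (rhoC r w x₀ * σ ^ 3) :=
      mul_nonneg ha.le (hsExcessFreeEnergy_nonneg _)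
    have he : 3 / 2 * rhoC r w x₀ * thetaC r w x₀ ≤ kinC r w x₀ := by
      unfold thetaC
      have hm : 0 ≤ ‖momC r w x₀‖ ^ 2 / (2 * rhoC r w x₀) := by positivity
      have : 3 / 2 * rhoC r w x₀ * (2 / 3 * (kinC r w x₀ / rhoC r w x₀ -
          ‖momC r w x₀‖ ^ 2 / (2 * rhoC r w x₀ ^ 2))) =
          kinC r w x₀ - ‖momC r w x₀‖ ^ 2 / (2 * rhoC r w x₀) := by
        field_simp
      rw [this]
      linarith
    have ht := tangent_le_ideal hΘ ha hθ he
    linarith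
  · unfold tangent
    have h1 : (5 / 2 - 3 / 2 * Real.log Θ) * rhoC r w x₀ ≤ 0 :=
      mul_nonpos_of_nonpos_of_nonneg (by linarith) ha0
    have h2 : 0 ≤ kinC r w x₀ / Θ := div_nonneg he0 hΘ.le
    linarith

/-! ## Exact integrals of the mollified conserved densities -/

/-- **Unit mass of the mollified density**: `∫ ρ_r dx₀ = 1` for `0 < r < 1/2` (finite sum through the integral,
`∫ b_r(y, ·) = 1`). [folklore] -/
theorem integral_rhoC_eq_one {r : ℝ} (hr : 0 < r) (hr2 : r < 1 / 2) (w : Config (N + 1) (Fin 3) T3) :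
    ∫ x₀, rhoC r w x₀ = 1 := by
  have h : (rhoC r w : T3 → ℝ) = fun x₀ => ((N + 1 : ℕ) : ℝ)⁻¹ * ∑ i, cone r (w i).1 x₀ := by
    funext x₀; unfold rhoC; rw [integral_empiricalMeasure]
  rw [h, integral_const_mul, integral_finsetSum Finset.univ (f := fun i a => cone r (w i).1 a)
    (fun i _ => integrable_of_continuous_T3 (continuous_cone r _))]
  have hone : ∀ i : Fin (N + 1), ∫ a, cone r (w i).1 a = 1 := fun i =>
    integral_cone_eq_one hr hr2 (w i).1
  simp_rw [hone]
  rw [Finset.sum_const, Finset.card_univ, Fintype.card_fin, nsmul_eq_mul, mul_one]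
  have hN : ((N + 1 : ℕ) : ℝ) ≠ 0 := by positivity
  exact inv_mul_cancel₀ hN

/-- **The mollified kinetic energy integrates to the mean kinetic energy**: `∫ e_r dx₀ = ke` for
`0 < r < 1/2`. [folklore] -/
theorem integral_kinC_eq_ke {r : ℝ} (hr : 0 < r) (hr2 : r < 1 / 2) (w : Config (N + 1) (Fin 3) T3) :
    ∫ x₀, kinC r w x₀ = ke w := by
  have hfun : kinC r w = fun x₀ => ((N + 1 : ℕ) : ℝ)⁻¹ * ∑ i, cone r (w i).1 x₀ * (‖(w i).2‖ ^ 2 / 2) :=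
    funext fun x₀ => kinC_eq_sum r w x₀
  rw [hfun, integral_const_mul,
    integral_finsetSum Finset.univ (f := fun i a => cone r (w i).1 a * (‖(w i).2‖ ^ 2 / 2))
      (fun i _ => integrable_of_continuous_T3 ((continuous_cone r _).mul continuous_const))]
  have hone : ∀ i : Fin (N + 1), ∫ a, cone r (w i).1 a * (‖(w i).2‖ ^ 2 / 2) = ‖(w i).2‖ ^ 2 / 2 := by
    intro i
    have h1 : ∫ a, cone r (w i).1 a = 1 := integral_cone_eq_one hr hr2 (w i).1
    rw [integral_mul_const, h1, one_mul]
  simp_rw [hone]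
  rfl

/-- **Closed-form integral of the tangent plane**: `∫ T_Θ(ρ_r, e_r) dx₀ = (3/2 - 3/2 log Θ) - ke/Θ`
(mass and energy bookkeeping). [folklore] -/
theorem integral_tangent_eq {r Θ : ℝ} (hr : 0 < r) (hr2 : r < 1 / 2) (w : Config (N + 1) (Fin 3) T3) :
    ∫ x₀, tangent Θ (rhoC r w x₀) (kinC r w x₀) = (3 / 2 - 3 / 2 * Real.log Θ) - ke w / Θ := by
  have hρ : Integrable (fun x₀ => rhoC r w x₀) := integrable_of_continuous_T3 (continuous_rhoC r w)
  have he : Integrable (fun x₀ => kinC r w x₀) := integrable_of_continuous_T3 (continuous_kinC r w)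
  have h1 : Integrable (fun x₀ => (5 / 2 - 3 / 2 * Real.log Θ) * rhoC r w x₀) := hρ.const_mul _
  have h2 : Integrable (fun x₀ => (5 / 2 - 3 / 2 * Real.log Θ) * rhoC r w x₀ - 1) :=
    h1.sub (integrable_const _)
  have h3 : Integrable (fun x₀ => kinC r w x₀ / Θ) := he.div_const _
  show ∫ x₀, ((5 / 2 - 3 / 2 * Real.log Θ) * rhoC r w x₀ - 1 - kinC r w x₀ / Θ) = _
  rw [integral_sub h2 h3, integral_sub h1 (integrable_const _), integral_const_mul,
    integral_rhoC_eq_one hr hr2, integral_div, integral_kinC_eq_ke hr hr2]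
  simp only [integral_const, smul_eq_mul, mul_one]
  rw [show (volume : Measure T3).real Set.univ = 1 by simp]
  ring

/-! ## The sure upper bound of the functional -/

/-- **Per-instant bound.** For a non-positive constant multiplier `c` the inner integral of the crux functional is
at most `c · ((3/2 - 3/2 log Θ) - ke/Θ)` (`3/2 log Θ ≥ 5/2`); the junk branch of the Bochner integral satisfies it
too (the right side is then `≥ 0`). [folklore] -/
theorem inner_le_tangent {σ r Θ : ℝ} (hr : 0 < r) (hr2 : r < 1 / 2) (hΘ : 0 < Θ)
    (hhot : 5 / 2 ≤ 3 / 2 * Real.log Θ) (w : Config (N + 1) (Fin 3) T3) {c : ℝ} (hc : c ≤ 0) :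
    ∫ x₀, Hs σ (rhoC r w x₀) (thetaC r w x₀) * c ≤ c * ((3 / 2 - 3 / 2 * Real.log Θ) - ke w / Θ) := by
  have hpt : ∀ x₀, Hs σ (rhoC r w x₀) (thetaC r w x₀) * c ≤
      tangent Θ (rhoC r w x₀) (kinC r w x₀) * c := fun x₀ =>
    mul_le_mul_of_nonpos_right (tangent_le_Hs (σ := σ) hr hΘ hhot w x₀) hc
  have hke := ke_nonneg w
  have hT : Integrable fun x₀ => tangent Θ (rhoC r w x₀) (kinC r w x₀) * c := by
    refine Integrable.mul_const ?_ _
    unfold tangent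
    exact (((integrable_of_continuous_T3 (continuous_rhoC r w)).const_mul _).sub
      (integrable_const _)).sub ((integrable_of_continuous_T3 (continuous_kinC r w)).div_const _)
  have hrhs : 0 ≤ c * ((3 / 2 - 3 / 2 * Real.log Θ) - ke w / Θ) := by
    refine mul_nonneg_of_nonpos_of_nonpos hc ?_
    have : 0 ≤ ke w / Θ := div_nonneg hke hΘ.le
    linarith
  by_cases hint : Integrable (fun x₀ => Hs σ (rhoC r w x₀) (thetaC r w x₀) * c)
  · calc ∫ x₀, Hs σ (rhoC r w x₀) (thetaC r w x₀) * c
        ≤ ∫ x₀, tangent Θ (rhoC r w x₀) (kinC r w x₀) * c := integral_mono hint hT hpt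
      _ = c * ((3 / 2 - 3 / 2 * Real.log Θ) - ke w / Θ) := by
          rw [integral_mul_const, integral_tangent_eq hr hr2 w]; ring
  · rw [integral_undef hint]
    exact hrhs

/-- **Sure upper bound of the entropy functional at a hot reference temperature.**  On the good set, for the
test function `φ(s, x) = ψ(s)` with `ψ` differentiable, `ψ'` continuous and `ψ` non-increasing (horizon `τ = 1`),
`I(z) ≤ (ψ 0 - ψ 1) · (3/2 log Θ - 3/2 + ke(z)/Θ)`: the tangent plane, the exact integrals of the conserved
densities, energy conservation along the flow and the fundamental theorem of calculus; junk branches included.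
No law of large numbers enters. [folklore] -/
theorem entropyFunctional_le_hot {σ r Θ : ℝ} (hr : 0 < r) (hr2 : r < 1 / 2) (hΘ : 0 < Θ)
    (hhot : 5 / 2 ≤ 3 / 2 * Real.log Θ)
    (Φ : HardSphereFlow (Torus.geometry (Fin 3)) (hsDiameter σ N) (N + 1))
    {ψ : ℝ → ℝ} (hψd : Differentiable ℝ ψ) (hψc : Continuous (deriv ψ)) (hanti : Antitone ψ)
    {z : Config (N + 1) (Fin 3) T3} (hz : z ∈ Φ.good) :
    entropyFunctional σ r 1 (fun s _ => ψ s) Φ z ≤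
      (ψ 0 - ψ 1) * (3 / 2 * Real.log Θ - 3 / 2 + ke z / Θ) := by
  have hpd : ∀ (k : Fin 3) (s : ℝ) (x : T3),
      Literature.Analysis.FunctionSpaces.Torus.partialDeriv k (fun _ : T3 => ψ s) x = 0 := by
    intro k s x
    simp [Literature.Analysis.FunctionSpaces.Torus.partialDeriv,
      Literature.Analysis.FunctionSpaces.Torus.lineDeriv]
  unfold entropyFunctional
  simp only [hpd, mul_zero, Finset.sum_const_zero, add_zero]
  set K : ℝ := 3 / 2 * Real.log Θ - 3 / 2 + ke z / Θ with hKdef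
  have hK : 0 ≤ K := by
    have : 0 ≤ ke z / Θ := div_nonneg (ke_nonneg z) hΘ.le
    rw [hKdef]; linarith
  have hG : ∀ s, ∫ x, Hs σ (rhoC r (Φ.flow s z) x) (thetaC r (Φ.flow s z) x) * deriv ψ s ≤
      -deriv ψ s * K := fun s => by
    have hds : deriv ψ s ≤ 0 := hanti.deriv_nonpos
    have h := inner_le_tangent (σ := σ) hr hr2 hΘ hhot (Φ.flow s z) hds
    rw [ke_flow_eq Φ hz s] at h
    have : deriv ψ s * ((3 / 2 - 3 / 2 * Real.log Θ) - ke z / Θ) = -deriv ψ s * K := by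
      rw [hKdef]; ring
    linarith
  have hFTC : ∫ s in Set.Icc (0 : ℝ) 1, -deriv ψ s * K = (ψ 0 - ψ 1) * K := by
    rw [integral_Icc_eq_integral_Ioc, ← intervalIntegral.integral_of_le zero_le_one,
      intervalIntegral.integral_mul_const, intervalIntegral.integral_neg,
      intervalIntegral.integral_deriv_eq_sub (fun x _ => hψd x) (hψc.intervalIntegrable _ _)]
    ring
  by_cases hint : IntegrableOn
      (fun s => ∫ x, Hs σ (rhoC r (Φ.flow s z) x) (thetaC r (Φ.flow s z) x) * deriv ψ s)
      (Set.Icc (0 : ℝ) 1)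
  · calc ∫ s in Set.Icc (0 : ℝ) 1, ∫ x, Hs σ (rhoC r (Φ.flow s z) x) (thetaC r (Φ.flow s z) x) * deriv ψ s
        ≤ ∫ s in Set.Icc (0 : ℝ) 1, -deriv ψ s * K :=
          integral_mono hint ((hψc.neg.mul continuous_const).integrableOn_Icc) hG
      _ = (ψ 0 - ψ 1) * K := hFTC
  · rw [integral_undef hint]
    exact mul_nonneg (sub_nonneg.2 (hanti zero_le_one)) hK

/-- **Pathwise saturation: the functional plus the matched boundary term is at most the excess free energy plus
the energy fluctuation.**  With `ψ = psi` (`ψ 0 = 1`, `ψ = 0` on `[1/2, ∞)`) and the hot matched Euler datum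
`(1, 0, Θ)`, `3/2 log Θ ≥ 5/2`, on `Φ.good`:
`I(z) + H(1, Θ) ≤ f_ex(σ³) + (ke(z) - 3Θ/2)/Θ`. [folklore] -/
theorem entropyFunctional_add_init_le {σ r Θ : ℝ} (hr : 0 < r) (hr2 : r < 1 / 2) (hΘ : 0 < Θ)
    (hhot : 5 / 2 ≤ 3 / 2 * Real.log Θ)
    (Φ : HardSphereFlow (Torus.geometry (Fin 3)) (hsDiameter σ N) (N + 1))
    {z : Config (N + 1) (Fin 3) T3} (hz : z ∈ Φ.good) :
    entropyFunctional σ r 1 (fun s _ => psi s) Φ z + Hs σ 1 Θ ≤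
      hsExcessFreeEnergy (σ ^ 3) + (ke z - 3 / 2 * Θ) / Θ := by
  have hψd : Differentiable ℝ psi := (psi_contDiff (n := 1)).differentiable (by simp)
  have hψc : Continuous (deriv psi) := (psi_contDiff (n := 1)).continuous_deriv (by simp)
  have hI := entropyFunctional_le_hot (σ := σ) hr hr2 hΘ hhot Φ hψd hψc psi_antitone hz
  rw [psi_zero, psi_eq_zero (by norm_num : (1 : ℝ) / 2 ≤ 1), sub_zero, one_mul] at hI
  have hHs : Hs σ 1 Θ = hsExcessFreeEnergy (σ ^ 3) - 3 / 2 * Real.log Θ := by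
    unfold Hs
    rw [if_pos ⟨one_pos, hΘ⟩, Real.log_one, one_mul]
    ring
  rw [hHs]
  have : (ke z - 3 / 2 * Θ) / Θ = ke z / Θ - 3 / 2 := by
    field_simp
  rw [this]
  linarith

/-! ## Saturation in probability: the conditional Chebyshev bound for the conserved kinetic energy -/

/-- **Chebyshev tail of the mean kinetic energy under the homogeneous local Gibbs law** at temperature `Θ`:
`P_N(t ≤ |ke - 3Θ/2|) ≤ (Θ²K/2)/((N+1) t²)` (conditionally on the positions the velocities are independent
`N(0, Θ)`; `K = gaussFourthMomentConst (Fin 3)`). [folklore] -/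
theorem localGibbsLaw_ke_tail_le {σ Θ : ℝ} (hΘ : 0 < Θ) (hσ : σ ≤ 1 / 2) (N : ℕ)
    (Φ : HardSphereFlow (Torus.geometry (Fin 3)) (hsDiameter σ N) (N + 1)) {t : ℝ} (ht : 0 < t) :
    localGibbsLaw σ (fun _ => 1) (fun _ => 0) (fun _ => Θ) N Φ {w | t ≤ |ke w - 3 / 2 * Θ|} ≤
      ENNReal.ofReal ((Θ ^ 2 / 2 * gaussFourthMomentConst (Fin 3)) / ((N + 1 : ℕ) * t ^ 2)) := by
  have hc1 : Continuous (fun _ : T3 => (1 : ℝ)) := continuous_const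
  have hcΘ : Continuous (fun _ : T3 => Θ) := continuous_const
  have hc0 : Continuous (fun _ : T3 => (0 : V3)) := continuous_const
  haveI := isProbabilityMeasure_localGibbsMeasure (u₀ := fun _ => (0 : V3)) hc1 hcΘ hc0
    (fun _ => one_pos) (fun _ => hΘ) hσ N
  rw [localGibbsLaw_eq]
  have hset : {w : Config (N + 1) (Fin 3) T3 | t ≤ |ke w - 3 / 2 * Θ|} =
      {w | t ≤ |((N + 1 : ℕ) : ℝ)⁻¹ * ∑ i, (fun _ : T3 => (1 : ℝ)) (w i).1 *
        (fun (_ : T3) (v : V3) => ‖v‖ ^ 2 / 2 - 3 / 2 * Θ) (w i).1 (w i).2|} := by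
    ext w
    simp only [Set.mem_setOf_eq, one_mul]
    have : ke w - 3 / 2 * Θ = ((N + 1 : ℕ) : ℝ)⁻¹ * ∑ i, (‖(w i).2‖ ^ 2 / 2 - 3 / 2 * Θ) := by
      unfold ke
      rw [Finset.sum_sub_distrib, Finset.sum_const, Finset.card_univ, Fintype.card_fin, nsmul_eq_mul,
        mul_sub]
      have hN : ((N + 1 : ℕ) : ℝ) ≠ 0 := by positivity
      field_simp
    rw [this]
  rw [hset]
  have hcen : ∀ x : T3, ∫ v, (fun (_ : T3) (v : V3) => ‖v‖ ^ 2 / 2 - 3 / 2 * Θ) x v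
      ∂gaussMeasure ((fun _ : T3 => (0 : V3)) x) ((fun _ : T3 => Θ) x) = 0 := by
    intro x
    have h := integral_energy_gaussMeasure (ι := Fin 3) (0 : V3) (θ := Θ) hΘ
    have hfun : (fun v : V3 => ‖v‖ ^ 2 / 2 - ‖(0 : V3)‖ ^ 2 / 2 - (Fintype.card (Fin 3) : ℝ) * Θ / 2) =
        fun v => ‖v‖ ^ 2 / 2 - 3 / 2 * Θ := by
      funext v; simp; ring
    rw [hfun] at h
    exact h
  have hvar : ∀ x : T3, ProbabilityTheory.variance
      ((fun (_ : T3) (v : V3) => ‖v‖ ^ 2 / 2 - 3 / 2 * Θ) x)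
      (gaussMeasure ((fun _ : T3 => (0 : V3)) x) ((fun _ : T3 => Θ) x)) ≤
      Θ ^ 2 / 2 * gaussFourthMomentConst (Fin 3) := by
    intro x
    have hm : AEMeasurable (fun v : V3 => ‖v‖ ^ 2 / 2 - 3 / 2 * Θ) (gaussMeasure (0 : V3) Θ) := by
      fun_prop
    show ProbabilityTheory.variance (fun v : V3 => ‖v‖ ^ 2 / 2 - 3 / 2 * Θ) (gaussMeasure (0 : V3) Θ) ≤ _
    rw [ProbabilityTheory.variance_eq_integral hm]
    have h0 : ∫ v, (fun v : V3 => ‖v‖ ^ 2 / 2 - 3 / 2 * Θ) v ∂gaussMeasure (0 : V3) Θ = 0 := hcen x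
    rw [h0]
    have h := integral_energy_sq_gaussMeasure_le (ι := Fin 3) (0 : V3) (θ := Θ) hΘ
    have hfun : (fun v : V3 => (‖v‖ ^ 2 / 2 - ‖(0 : V3)‖ ^ 2 / 2 - (Fintype.card (Fin 3) : ℝ) * Θ / 2) ^ 2) =
        fun v => (‖v‖ ^ 2 / 2 - 3 / 2 * Θ - 0) ^ 2 := by
      funext v; simp; ring
    rw [hfun] at h
    simpa using h
  refine (localGibbsMeasure_velFluct_le hc1 hcΘ hc0 (fun _ => zero_le_one) (fun _ => hΘ) σ N
    (Y := fun (_ : T3) (v : V3) => ‖v‖ ^ 2 / 2 - 3 / 2 * Θ) (by fun_prop)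
    (fun _ => memLp_energy_gaussMeasure (0 : V3) Θ (3 / 2 * Θ)) hcen hvar continuous_const
    (C := 1) (fun _ => by simp) ht).trans ?_
  rw [one_pow, one_mul]

/-- **Saturation in probability (quantitative tightness of `LocalSecondLaw` at equilibrium).**  For the
homogeneous hot local Gibbs data `(a₀, θ₀, u₀) = (1, Θ, 0)` with `3/2 log Θ ≥ 5/2`, EVERY hard-sphere flow, the
matched Euler datum `(1, 0, Θ)`, the test function `ψ`, `0 < r < 1/2`, `σ ≤ 1/2` and every `t > 0`, `N`:

  `P_N( f_ex(σ³) + t ≤ I + init ) ≤ K / (2 (N+1) t²)`.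

So the crux's functional exceeds the excess free energy `f_ex(σ³) = O(σ³)` only by the `O_P(N^{-1/2})` canonical
energy fluctuation: the local entropy inequality is saturated at equilibrium up to `f_ex(σ³)`, with an explicit
rate (pathwise bound `entropyFunctional_add_init_le` + `localGibbsLaw_ke_tail_le`; `Φ.good` is conull). [folklore] -/
theorem localGibbsLaw_saturation_tail {σ r Θ : ℝ} (hr : 0 < r) (hr2 : r < 1 / 2) (hΘ : 0 < Θ)
    (hhot : 5 / 2 ≤ 3 / 2 * Real.log Θ) (hσ : σ ≤ 1 / 2) (N : ℕ)
    (Φ : HardSphereFlow (Torus.geometry (Fin 3)) (hsDiameter σ N) (N + 1)) {t : ℝ} (ht : 0 < t) :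
    localGibbsLaw σ (fun _ => 1) (fun _ => 0) (fun _ => Θ) N Φ
        {z | hsExcessFreeEnergy (σ ^ 3) + t ≤ entropyFunctional σ r 1 (fun s _ => psi s) Φ z + Hs σ 1 Θ} ≤
      ENNReal.ofReal (gaussFourthMomentConst (Fin 3) / (2 * ((N + 1 : ℕ) * t ^ 2))) := by
  set LG := localGibbsLaw σ (fun _ => 1) (fun _ => 0) (fun _ => Θ) N Φ with hLG
  have htΘ : 0 < t * Θ := mul_pos ht hΘ
  -- on the good set the event forces a large energy fluctuation
  have hsub : {z | hsExcessFreeEnergy (σ ^ 3) + t ≤ entropyFunctional σ r 1 (fun s _ => psi s) Φ z + Hs σ 1 Θ}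
      ⊆ {w | t * Θ ≤ |ke w - 3 / 2 * Θ|} ∪ (Φ.good)ᶜ := by
    intro z hz
    by_cases hzg : z ∈ Φ.good
    · left
      have hb := entropyFunctional_add_init_le (σ := σ) hr hr2 hΘ hhot Φ hzg
      have h1 : t ≤ (ke z - 3 / 2 * Θ) / Θ := by
        have := hz; rw [Set.mem_setOf_eq] at this; linarith
      have h2 : t * Θ ≤ ke z - 3 / 2 * Θ := by rwa [le_div_iff₀ hΘ] at h1
      exact h2.trans (le_abs_self _)
    · right; exact hzg
  have hg0 : LG (Φ.good)ᶜ = 0 := by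
    have hac : LG ≪ liouville (Torus.geometry (Fin 3)) (N + 1) (hsDiameter σ N) :=
      withDensity_absolutelyContinuous _ _
    exact hac Φ.measure_compl_good
  calc LG {z | hsExcessFreeEnergy (σ ^ 3) + t ≤ entropyFunctional σ r 1 (fun s _ => psi s) Φ z + Hs σ 1 Θ}
      ≤ LG ({w | t * Θ ≤ |ke w - 3 / 2 * Θ|} ∪ (Φ.good)ᶜ) := measure_mono hsub
    _ ≤ LG {w | t * Θ ≤ |ke w - 3 / 2 * Θ|} + LG (Φ.good)ᶜ := measure_union_le _ _
    _ = LG {w | t * Θ ≤ |ke w - 3 / 2 * Θ|} := by rw [hg0, add_zero]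
    _ ≤ ENNReal.ofReal ((Θ ^ 2 / 2 * gaussFourthMomentConst (Fin 3)) / ((N + 1 : ℕ) * (t * Θ) ^ 2)) :=
        localGibbsLaw_ke_tail_le hΘ hσ N Φ htΘ
    _ = ENNReal.ofReal (gaussFourthMomentConst (Fin 3) / (2 * ((N + 1 : ℕ) * t ^ 2))) := by
        congr 1
        have hN : (0 : ℝ) < (N + 1 : ℕ) := by positivity
        field_simp


/-! ## (f') Cycle 2 — the probabilistic half of the `η = 0` near-miss: kinetic-energy CLT under the local Gibbs law

Landing as `Theorems/LocalSecondLaw/Negative/KineticEnergyCLT.lean` (p80994).  Conditionally on the positions the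
velocities of the homogeneous local Gibbs law are i.i.d. `N(0, Θ𝟙)`, so Mathlib's central limit theorem
(`ProbabilityTheory.tendstoInDistribution_inv_sqrt_mul_sum_sub`) on the i.i.d. model
`Measure.infinitePi (fun _ : ℕ => gaussMeasure 0 Θ)`, the portmanteau lower bound for the open half-line, the
finite-dimensional marginal and the position/velocity disintegration give
`P(G < a) ≤ liminf_N P_N(ke − 3Θ/2 < a (N+1)^{-1/2})` with `G ~ N(0, limVar Θ)`, `limVar Θ ≠ 0`
(`le_liminf_localGibbsLaw_ke_lt`, `limVar_ne_zero`, `gaussianReal_Iio_pos`): the canonical energy fluctuation —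
the only `O_P(N^{-1/2})` term in the saturation bound of §(b'') — has an asymptotically symmetric non-degenerate
SIGN.  What is still missing for `¬ LocalSecondLawZeroEta` is the statics input (I1) of the docblock §(f):
`E_Gibbs|ρ_r(x) − 1|² ≤ C(r, σ)/(N+1)`. -/

section KineticEnergyCLT

open ProbabilityTheory
open scoped NNReal

/-! ## The one-particle observable and the i.i.d. model -/

/-- The centred one-particle kinetic energy `X(v) = |v|²/2 − 3Θ/2`. [folklore] -/
def Xe (Θ : ℝ) (v : V3) : ℝ := ‖v‖ ^ 2 / 2 - 3 / 2 * Θ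

/-- `X` is continuous. [folklore] -/
theorem continuous_Xe (Θ : ℝ) : Continuous (Xe Θ) := by
  unfold Xe; fun_prop

/-- `X` is measurable. [folklore] -/
theorem measurable_Xe (Θ : ℝ) : Measurable (Xe Θ) := (continuous_Xe Θ).measurable

/-- The i.i.d. model: countably many independent `N(0, Θ 𝟙)` velocities. [folklore] -/
def iidGauss (Θ : ℝ) : Measure (ℕ → V3) := Measure.infinitePi (fun _ : ℕ => gaussMeasure (0 : V3) Θ)

/-- The i.i.d. model is a probability measure (new instance on a new definition). [folklore] -/
instance isProbabilityMeasure_iidGauss (Θ : ℝ) : IsProbabilityMeasure (iidGauss Θ) := by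
  unfold iidGauss; infer_instance

/-- The coordinate energies are independent. [folklore] -/
theorem iIndepFun_Xe (Θ : ℝ) : iIndepFun (fun k (ω : ℕ → V3) => Xe Θ (ω k)) (iidGauss Θ) :=
  iIndepFun_infinitePi (P := fun _ : ℕ => gaussMeasure (0 : V3) Θ) (X := fun _ => Xe Θ)
    (fun _ => measurable_Xe Θ)

/-- The law of a coordinate energy is the image of `N(0, Θ 𝟙)` under `X`. [folklore] -/
theorem map_Xe_eval (Θ : ℝ) (k : ℕ) :
    (iidGauss Θ).map (fun ω => Xe Θ (ω k)) = (gaussMeasure (0 : V3) Θ).map (Xe Θ) := by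
  have h : (fun ω : ℕ → V3 => Xe Θ (ω k)) = Xe Θ ∘ Function.eval k := rfl
  rw [h, ← Measure.map_map (measurable_Xe Θ) (measurable_pi_apply k)]
  congr 1
  exact (measurePreserving_eval_infinitePi (fun _ : ℕ => gaussMeasure (0 : V3) Θ) k).map_eq

/-- The coordinate energies are identically distributed. [folklore] -/
theorem identDistrib_Xe (Θ : ℝ) (i : ℕ) :
    IdentDistrib (fun ω : ℕ → V3 => Xe Θ (ω i)) (fun ω => Xe Θ (ω 0)) (iidGauss Θ) (iidGauss Θ) where
  aemeasurable_fst := ((measurable_Xe Θ).comp (measurable_pi_apply i)).aemeasurable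
  aemeasurable_snd := ((measurable_Xe Θ).comp (measurable_pi_apply 0)).aemeasurable
  map_eq := by rw [map_Xe_eval, map_Xe_eval]

/-- The first coordinate energy has the one-particle law. [folklore] -/
theorem identDistrib_Xe_gauss (Θ : ℝ) :
    IdentDistrib (fun ω : ℕ → V3 => Xe Θ (ω 0)) (Xe Θ) (iidGauss Θ) (gaussMeasure (0 : V3) Θ) where
  aemeasurable_fst := ((measurable_Xe Θ).comp (measurable_pi_apply 0)).aemeasurable
  aemeasurable_snd := (measurable_Xe Θ).aemeasurable
  map_eq := by rw [map_Xe_eval]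

/-- `X` is centred under `N(0, Θ 𝟙)`. [folklore] -/
theorem integral_Xe_gauss {Θ : ℝ} (hΘ : 0 < Θ) : ∫ v, Xe Θ v ∂gaussMeasure (0 : V3) Θ = 0 := by
  have h := integral_energy_gaussMeasure (ι := Fin 3) (0 : V3) (θ := Θ) hΘ
  have hfun : (fun v : V3 => ‖v‖ ^ 2 / 2 - ‖(0 : V3)‖ ^ 2 / 2 - (Fintype.card (Fin 3) : ℝ) * Θ / 2) =
      Xe Θ := by
    funext v; simp [Xe]; ring
  rw [hfun] at h
  exact h

/-- `X ∈ L²` under `N(0, Θ 𝟙)`. [folklore] -/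
theorem memLp_Xe_gauss (Θ : ℝ) : MemLp (Xe Θ) 2 (gaussMeasure (0 : V3) Θ) :=
  memLp_energy_gaussMeasure (0 : V3) Θ (3 / 2 * Θ)

/-- The first coordinate energy is in `L²`. [folklore] -/
theorem memLp_Xe0 (Θ : ℝ) : MemLp (fun ω : ℕ → V3 => Xe Θ (ω 0)) 2 (iidGauss Θ) :=
  (identDistrib_Xe_gauss Θ).symm.memLp_snd (memLp_Xe_gauss Θ)

/-- The first coordinate energy is centred. [folklore] -/
theorem integral_Xe0 {Θ : ℝ} (hΘ : 0 < Θ) : (iidGauss Θ)[fun ω : ℕ → V3 => Xe Θ (ω 0)] = 0 := by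
  rw [(identDistrib_Xe_gauss Θ).integral_eq]
  exact integral_Xe_gauss hΘ

/-- `N(0, Θ 𝟙)` charges the ball of radius `√Θ` (positive Maxwellian density). [folklore] -/
theorem gaussMeasure_ball_ne_zero {Θ : ℝ} (hΘ : 0 < Θ) :
    gaussMeasure (0 : V3) Θ (Metric.ball 0 (Real.sqrt Θ)) ≠ 0 := by
  rw [← withDensity_localMaxwellian_eq_gaussMeasure hΘ (0 : V3), withDensity_apply _ measurableSet_ball]
  intro h0
  have hm : Measurable fun v : V3 => ENNReal.ofReal (localMaxwellian 1 Θ (0 : V3) v) :=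
    (continuous_localMaxwellian 1 Θ (0 : V3)).measurable.ennreal_ofReal
  rw [lintegral_eq_zero_iff hm] at h0
  have hset : {v : V3 | (fun v => ENNReal.ofReal (localMaxwellian 1 Θ (0 : V3) v)) v ≠ (0 : V3 → ℝ≥0∞) v}
      = Set.univ := by
    ext v
    simp only [Set.mem_setOf_eq, Pi.zero_apply, ne_eq, ENNReal.ofReal_eq_zero, not_le, Set.mem_univ,
      iff_true]
    exact localMaxwellian_pos one_pos hΘ _ _
  have h1 : (volume.restrict (Metric.ball (0 : V3) (Real.sqrt Θ))) Set.univ = 0 := by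
    rw [← hset]
    exact h0
  rw [Measure.restrict_apply_univ] at h1
  exact (Metric.measure_ball_pos volume (0 : V3) (Real.sqrt_pos.2 hΘ)).ne' h1

/-- The one-particle energy has NON-ZERO variance under `N(0, Θ 𝟙)` (it is `≤ −Θ` on the ball of radius
`√Θ`, which has positive Gaussian mass). [folklore] -/
theorem variance_Xe_gauss_ne_zero {Θ : ℝ} (hΘ : 0 < Θ) : Var[Xe Θ; gaussMeasure (0 : V3) Θ] ≠ 0 := by
  intro h0
  have hae := ae_eq_integral_of_variance_eq_zero (memLp_Xe_gauss Θ) h0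
  rw [integral_Xe_gauss hΘ] at hae
  -- the ball is contained in `{X ≠ 0}`
  have hball : Metric.ball (0 : V3) (Real.sqrt Θ) ⊆ {v | Xe Θ v ≠ 0} := by
    intro v hv
    rw [Metric.mem_ball, dist_zero_right] at hv
    have h1 : ‖v‖ ^ 2 < Θ := by
      have hs : Real.sqrt Θ ^ 2 = Θ := Real.sq_sqrt hΘ.le
      nlinarith [norm_nonneg v, Real.sqrt_nonneg Θ]
    show Xe Θ v ≠ 0
    unfold Xe
    intro h2
    nlinarith
  have hzero : gaussMeasure (0 : V3) Θ {v | Xe Θ v ≠ 0} = 0 := ae_iff.1 hae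
  exact gaussMeasure_ball_ne_zero hΘ (measure_mono_null hball hzero)

/-- Non-zero variance in the i.i.d. model. [folklore] -/
theorem variance_Xe0_ne_zero {Θ : ℝ} (hΘ : 0 < Θ) : Var[fun ω : ℕ → V3 => Xe Θ (ω 0); iidGauss Θ] ≠ 0 := by
  rw [(identDistrib_Xe_gauss Θ).variance_eq]
  exact variance_Xe_gauss_ne_zero hΘ

/-! ## The central limit theorem and the portmanteau lower bound -/

/-- The limit variance (as a non-negative real). [folklore] -/
def limVar (Θ : ℝ) : ℝ≥0 := (Var[fun ω : ℕ → V3 => Xe Θ (ω 0); iidGauss Θ]).toNNReal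

/-- The limit variance is non-zero. [folklore] -/
theorem limVar_ne_zero {Θ : ℝ} (hΘ : 0 < Θ) : limVar Θ ≠ 0 := by
  unfold limVar
  intro h
  rw [Real.toNNReal_eq_zero] at h
  exact variance_Xe0_ne_zero hΘ (le_antisymm h (variance_nonneg _ _))

/-- The normalised partial sums `(√n)⁻¹ ∑_{k<n} X(ω k)`. [folklore] -/
def Zn (Θ : ℝ) (n : ℕ) (ω : ℕ → V3) : ℝ := (Real.sqrt n)⁻¹ * ∑ k ∈ Finset.range n, Xe Θ (ω k)

/-- The normalised partial sums are measurable. [folklore] -/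
theorem measurable_Zn (Θ : ℝ) (n : ℕ) : Measurable (Zn Θ n) := by
  unfold Zn
  refine measurable_const.mul (Finset.measurable_sum _ fun k _ => ?_)
  exact (measurable_Xe Θ).comp (measurable_pi_apply k)

/-- **CLT for the kinetic energy in the i.i.d. model**: `Zn ⇒ N(0, limVar)`. [folklore] -/
theorem tendstoInDistribution_Zn {Θ : ℝ} (hΘ : 0 < Θ) :
    TendstoInDistribution (fun n ω => Zn Θ n ω) atTop (id : ℝ → ℝ) (fun _ => iidGauss Θ)
      (gaussianReal 0 (limVar Θ)) := by
  have hY : HasLaw (id : ℝ → ℝ) (gaussianReal 0 (Var[fun ω : ℕ → V3 => Xe Θ (ω 0); iidGauss Θ]).toNNReal)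
      (gaussianReal 0 (limVar Θ)) := ⟨aemeasurable_id, Measure.map_id⟩
  have h := tendstoInDistribution_inv_sqrt_mul_sum_sub (X := fun k (ω : ℕ → V3) => Xe Θ (ω k))
    (P := iidGauss Θ) hY (memLp_Xe0 Θ) (iIndepFun_Xe Θ) (identDistrib_Xe Θ)
  rw [integral_Xe0 hΘ] at h
  have hfun : (fun (n : ℕ) (ω : ℕ → V3) => (Real.sqrt n)⁻¹ *
      (∑ k ∈ Finset.range n, Xe Θ (ω k) - n * 0)) = fun n ω => Zn Θ n ω := by
    funext n ω; simp [Zn]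
  rw [hfun] at h
  exact h

/-- **Portmanteau**: the liminf of the probabilities of `{Zn < a}` is at least the Gaussian mass of `(-∞, a)`.
[folklore] -/
theorem le_liminf_iidGauss_Zn_lt {Θ : ℝ} (hΘ : 0 < Θ) (a : ℝ) :
    gaussianReal 0 (limVar Θ) (Iio a) ≤ liminf (fun n => iidGauss Θ {ω | Zn Θ n ω < a}) atTop := by
  have h := tendstoInDistribution_Zn hΘ
  have hl := ProbabilityMeasure.le_liminf_measure_open_of_tendsto h.tendsto (G := Iio a) isOpen_Iio
  simp only [ProbabilityMeasure.coe_mk, Measure.map_id] at hl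
  refine hl.trans (le_of_eq ?_)
  refine liminf_congr (Eventually.of_forall fun n => ?_)
  rw [Measure.map_apply (measurable_Zn Θ n) measurableSet_Iio]
  rfl

/-- The Gaussian mass of a half-line is positive (non-degenerate variance). [folklore] -/
theorem gaussianReal_Iio_pos {v : ℝ≥0} (hv : v ≠ 0) (a : ℝ) : 0 < gaussianReal 0 v (Iio a) := by
  have hac := gaussianReal_absolutelyContinuous' 0 hv
  refine pos_iff_ne_zero.2 fun h0 => ?_
  have h1 : (volume : Measure ℝ) (Iio a) = 0 := hac h0
  simp at h1

/-! ## From the i.i.d. model to the finite products and to the local Gibbs law -/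

/-- The event `{∑_{i<n} X(vᵢ) < a √n}` on `n` velocities. [folklore] -/
def sumEvent (Θ : ℝ) (n : ℕ) (a : ℝ) : Set (Fin n → V3) :=
  {v | ∑ i, Xe Θ (v i) < a * Real.sqrt n}

/-- The sum event is measurable. [folklore] -/
theorem measurableSet_sumEvent (Θ : ℝ) (n : ℕ) (a : ℝ) : MeasurableSet (sumEvent Θ n a) := by
  unfold sumEvent
  refine measurableSet_lt (Finset.measurable_sum _ fun i _ => ?_) measurable_const
  exact (measurable_Xe Θ).comp (measurable_pi_apply i)

/-- **Finite-dimensional marginal**: the i.i.d. model's probability of `{Zn < a}` is the `n`-fold product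
Gaussian probability of `sumEvent`. [folklore] -/
theorem iidGauss_Zn_lt_eq {Θ : ℝ} (n : ℕ) (hn : 0 < n) (a : ℝ) :
    iidGauss Θ {ω | Zn Θ n ω < a} =
      Measure.pi (fun _ : Fin n => gaussMeasure (0 : V3) Θ) (sumEvent Θ n a) := by
  have hproj : (iidGauss Θ).map (fun (ω : ℕ → V3) (i : Fin n) => ω (i : ℕ)) =
      Measure.pi (fun _ : Fin n => gaussMeasure (0 : V3) Θ) := by
    unfold iidGauss
    rw [Measure.map_infinitePi_infinitePi_of_inj (P := fun _ : ℕ => gaussMeasure (0 : V3) Θ)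
      (f := fun i : Fin n => (i : ℕ)) Fin.val_injective, Measure.infinitePi_eq_pi]
  have hmeas : Measurable (fun (ω : ℕ → V3) (i : Fin n) => ω (i : ℕ)) :=
    measurable_pi_lambda _ fun i => measurable_pi_apply _
  rw [← hproj, Measure.map_apply hmeas (measurableSet_sumEvent Θ n a)]
  congr 1
  ext ω
  simp only [Set.mem_setOf_eq, Set.mem_preimage, sumEvent, Zn]
  rw [Fin.sum_univ_eq_sum_range (fun k => Xe Θ (ω k)) n]
  have hs : 0 < Real.sqrt n := Real.sqrt_pos.2 (by exact_mod_cast hn)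
  rw [inv_mul_lt_iff₀ hs]
  constructor <;> intro h <;> linarith [mul_comm a (Real.sqrt n)]

/-- **Velocity-only events under the local Gibbs law**: for the homogeneous profiles `(1, Θ, 0)` the
probability of an event depending only on the velocities is its product-Gaussian probability
(position/velocity disintegration; the velocity law does not depend on the positions). [folklore] -/
theorem localGibbsMeasure_vel_event {σ Θ : ℝ} (hΘ : 0 < Θ) (hσ : σ ≤ 1 / 2) (N : ℕ)
    {E : Set (Fin (N + 1) → V3)} (hE : MeasurableSet E) :
    localGibbsMeasure σ (fun _ => 1) (fun _ => 0) (fun _ => Θ) N {z | (fun i => (z i).2) ∈ E} =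
      Measure.pi (fun _ : Fin (N + 1) => gaussMeasure (0 : V3) Θ) E := by
  have hc1 : Continuous (fun _ : T3 => (1 : ℝ)) := continuous_const
  have hcΘ : Continuous (fun _ : T3 => Θ) := continuous_const
  have hc0 : Continuous (fun _ : T3 => (0 : V3)) := continuous_const
  haveI := isProbabilityMeasure_localGibbsMeasure (u₀ := fun _ => (0 : V3)) hc1 hcΘ hc0
    (fun _ => one_pos) (fun _ => hΘ) hσ N
  set A : Set (Config (N + 1) (Fin 3) T3) := {z | (fun i => (z i).2) ∈ E} with hA
  have hvm : Measurable fun z : Config (N + 1) (Fin 3) T3 => fun i => (z i).2 :=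
    measurable_pi_lambda _ fun i => (measurable_pi_apply i).snd
  have hAm : MeasurableSet A := hvm hE
  have hvel : ∀ x : Fin (N + 1) → T3,
      velMeasure (fun _ => (0 : V3)) (fun _ => Θ) x {v | zipConfig (x, v) ∈ A} =
        Measure.pi (fun _ : Fin (N + 1) => gaussMeasure (0 : V3) Θ) E := by
    intro x
    have hset : {v : Fin (N + 1) → V3 | zipConfig (x, v) ∈ A} = E := by
      ext v
      simp [hA]
    rw [hset]
    rfl
  calc localGibbsMeasure σ (fun _ => 1) (fun _ => 0) (fun _ => Θ) N A
      = ∫⁻ z, A.indicator 1 z ∂localGibbsMeasure σ (fun _ => 1) (fun _ => 0) (fun _ => Θ) N :=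
        (lintegral_indicator_one hAm).symm
    _ = ∫⁻ x, ENNReal.ofReal ((canonicalPartition (Torus.geometry (Fin 3)) (hsDiameter σ N)
          (N + 1) (localGibbsProfile (fun _ => 1) (fun _ => 0) (fun _ => Θ)))⁻¹ *
            posWeight (fun _ => 1) (hsDiameter σ N) (N + 1) x) *
          velMeasure (fun _ => (0 : V3)) (fun _ => Θ) x {v | zipConfig (x, v) ∈ A} := by
        rw [lintegral_localGibbsMeasure hc1 hcΘ hc0 (fun _ => zero_le_one) (fun _ => hΘ) σ N
          (measurable_one.indicator hAm)]
        refine lintegral_congr fun x => ?_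
        congr 1
        have hpre : MeasurableSet {v : Fin (N + 1) → V3 | zipConfig (x, v) ∈ A} :=
          hAm.preimage (measurable_zipConfig.comp (measurable_const.prodMk measurable_id))
        rw [← lintegral_indicator_one hpre]
        rfl
    _ = ∫⁻ x, ENNReal.ofReal ((canonicalPartition (Torus.geometry (Fin 3)) (hsDiameter σ N)
          (N + 1) (localGibbsProfile (fun _ => 1) (fun _ => 0) (fun _ => Θ)))⁻¹ *
            posWeight (fun _ => 1) (hsDiameter σ N) (N + 1) x) *
          Measure.pi (fun _ : Fin (N + 1) => gaussMeasure (0 : V3) Θ) E := by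
        simp_rw [hvel]
    _ = Measure.pi (fun _ : Fin (N + 1) => gaussMeasure (0 : V3) Θ) E := by
        have hρm : Measurable fun x : Fin (N + 1) → T3 => ENNReal.ofReal
            ((canonicalPartition (Torus.geometry (Fin 3)) (hsDiameter σ N) (N + 1)
              (localGibbsProfile (fun _ => 1) (fun _ => 0) (fun _ => Θ)))⁻¹ *
              posWeight (fun _ => 1) (hsDiameter σ N) (N + 1) x) :=
          (measurable_const.mul (measurable_posWeight hc1 _ _)).ennreal_ofReal
        rw [lintegral_mul_const _ hρm, lintegral_posWeight_eq_one hc1 hcΘ hc0 (fun _ => zero_le_one)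
          (fun _ => hΘ) σ N, one_mul]

/-- The mean kinetic energy `(N+1)⁻¹ ∑ |vᵢ|²/2` of a configuration (same body as `Functional.ke`). [folklore] -/
def keC {N : ℕ} (w : Config (N + 1) (Fin 3) T3) : ℝ :=
  ((N + 1 : ℕ) : ℝ)⁻¹ * ∑ i, ‖(w i).2‖ ^ 2 / 2

/-- The energy-deficit event `{ke − 3Θ/2 < a (N+1)^{-1/2}}` is the velocity event `sumEvent`. [folklore] -/
theorem setOf_keC_lt_eq {Θ : ℝ} (N : ℕ) (a : ℝ) :
    {z : Config (N + 1) (Fin 3) T3 | keC z - 3 / 2 * Θ < a * (Real.sqrt (N + 1 : ℕ))⁻¹} =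
      {z | (fun i => (z i).2) ∈ sumEvent Θ (N + 1) a} := by
  ext z
  simp only [Set.mem_setOf_eq, sumEvent, Xe, keC]
  rw [Finset.sum_sub_distrib, Finset.sum_const, Finset.card_univ, Fintype.card_fin, nsmul_eq_mul]
  set n : ℝ := ((N + 1 : ℕ) : ℝ) with hn'
  set S : ℝ := ∑ i, ‖(z i).2‖ ^ 2 / 2 with hS
  have hN : 0 < n := by rw [hn']; positivity
  have hn0 : n ≠ 0 := hN.ne'
  have hs : 0 < Real.sqrt n := Real.sqrt_pos.2 hN
  have hs0 : Real.sqrt n ≠ 0 := hs.ne'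
  have hsq : Real.sqrt n * Real.sqrt n = n := Real.mul_self_sqrt hN.le
  have h1 : a * (Real.sqrt n)⁻¹ = (a * Real.sqrt n) / n := by
    rw [eq_div_iff hn0]
    calc a * (Real.sqrt n)⁻¹ * n = a * (Real.sqrt n)⁻¹ * (Real.sqrt n * Real.sqrt n) := by rw [hsq]
      _ = a * Real.sqrt n := by field_simp
  have h2 : n⁻¹ * S - 3 / 2 * Θ = (S - n * (3 / 2 * Θ)) / n := by
    field_simp
  rw [h1, h2, div_lt_div_iff_of_pos_right hN]

/-- **The kinetic-energy CLT under the local Gibbs law (liminf form).**  For the homogeneous local Gibbs data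
`(1, Θ, 0)`, `Θ > 0`, `σ ≤ 1/2`, every flow family and every `a ∈ ℝ`:

  `P(G < a) ≤ liminf_N P_N( ke − 3Θ/2 < a (N+1)^{-1/2} )`,  `G ~ N(0, limVar Θ)`, `limVar Θ ≠ 0`,

so the deficit event `{ke < 3Θ/2 − |a| (N+1)^{-1/2}}` keeps probability `≥ P(G < −|a|) > 0` — the canonical energy
fluctuation has an asymptotically symmetric, non-degenerate sign. [folklore] -/
theorem le_liminf_localGibbsLaw_ke_lt {σ Θ : ℝ} (hΘ : 0 < Θ) (hσ : σ ≤ 1 / 2)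
    (Φ : (N : ℕ) → HardSphereFlow (Torus.geometry (Fin 3)) (hsDiameter σ N) (N + 1)) (a : ℝ) :
    gaussianReal 0 (limVar Θ) (Iio a) ≤
      liminf (fun N => localGibbsLaw σ (fun _ => 1) (fun _ => 0) (fun _ => Θ) N (Φ N)
        {z | keC z - 3 / 2 * Θ < a * (Real.sqrt (N + 1 : ℕ))⁻¹}) atTop := by
  have h1 := le_liminf_iidGauss_Zn_lt hΘ a
  -- identify the two sequences along `n = N + 1`
  have hident : ∀ N : ℕ, localGibbsLaw σ (fun _ => 1) (fun _ => 0) (fun _ => Θ) N (Φ N)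
      {z | keC z - 3 / 2 * Θ < a * (Real.sqrt (N + 1 : ℕ))⁻¹} = iidGauss Θ {ω | Zn Θ (N + 1) ω < a} := by
    intro N
    rw [localGibbsLaw_eq, setOf_keC_lt_eq, localGibbsMeasure_vel_event hΘ hσ N (measurableSet_sumEvent Θ _ a),
      iidGauss_Zn_lt_eq (N + 1) (Nat.succ_pos N) a]
  simp_rw [hident]
  rw [Filter.liminf_nat_add (fun n => iidGauss Θ {ω | Zn Θ n ω < a}) 1]
  exact h1

end KineticEnergyCLT

end Summit.AtomisticToContinuum.HydrodynamicLimit.Cruxes.LocalSecondLaw.Disproof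

end
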